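import Literature.AlgebraicGeometry.HodgeTheory.HeckePrymF21WeilTwelvefoldWeilType
import Literature.AlgebraicGeometry.HodgeTheory.WeilClassesCyclicPrymDegreeSevenDimension
import Literature.AlgebraicGeometry.HodgeTheory.WeilClassesCyclicPrymDegreeThree
import HarnessLib

/-!
# `exists_heckePrymDatum_F21`: `dim P' = 12` by Chevalley–Weil from `H¹(J) ≅ H¹(C)` (Smith theory)

Third proof file of the named fact
`Literature.AlgebraicGeometry.HodgeTheory.exists_heckePrymDatum_F21` (`HeckePrymF21WeilTwelvefold`).
`HeckePrymF21WeilTwelvefoldProofs` proved the Hecke-algebra half; `HeckePrymF21WeilTwelvefoldWeilType`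
derived the Weil CLASS from the Weil TYPE `(6,6)`. This file PROVES the dimension conjunct
`dim P' = 12` of the fact — "`H¹(P') = H¹(B)^τ` has dimension `24`" (docstring of the fact;
Chevalley–Weil for the étale `F₂₁`-cover, [LangeRodriguez2022, §3.2 (3.6), §3.5 Cor. 3.5.9–3.5.10])
— from the single named fact `Motives.isIso_bettiCohomology_map_abelJacobi` (`H¹(J(C)) ≅ H¹(C)`),
exactly as `WeilClassesCyclicPrymDegreeSevenDimension` did for `dim B = 36`, WITHOUT the Lefschetz
fixed point formula and without character tables:

* §1 (linear algebra of `F₂₁ = ⟨S, T | S⁷ = T³ = 1, ST = TS²⟩` on a finite-dimensional `ℂ`-space)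
  **`twentyOne_mul_finrank_inf_add`**:
  `21 · dim (V^S ∩ V^T) + 7 · dim V = 7 · dim V^S + 21 · dim V^T` — the projector
  `(1/21) (Σ_{i<7} Sⁱ)(Σ_{j<3} Tʲ)` onto the invariants `V^{F₂₁} = V^S ∩ V^T` (Serre §2.3) has trace
  `(1/21) Σ_{i,j} tr(SⁱTʲ)`, and `tr(SⁱT) = tr(T)`, `tr(SⁱT²) = tr(T²)` for all `i` (the elements
  `σⁱτ^{±1}` are conjugate to `τ^{±1}` under `⟨σ⟩`), while `Σ_{i<7} tr(Sⁱ) = 7 dim V^S` and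
  `tr 1 + tr T + tr T² = 3 dim V^T` (`card_mul_finrank_ker_eq_sum_trace_pow`);
* §1 **`finrank_ker_sub_one_add_finrank_inf_eq`**: for a `T`-equivariant SURJECTION `I : V ↠ H`
  (`I ∘ T = T_H ∘ I`, `Tᵐ = 1`), `dim H^{T_H} + dim (V^T ∩ ker I) = dim V^T` (invariants are exact
  in characteristic `0`: averaging lifts invariants);
* §2 (the curve) **`three_mul_finrank_ker_sub_one_eq`**: for a free automorphism `τ` of order `3`
  of a smooth projective complex curve, `3 · dim H¹(C(ℂ); ℂ)^τ = 4 + b₁(C)` — Smith theory and the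
  transfer on the closed surface `C(ℂ)` (`OrbitSpace.euler_eq_prime_mul_euler`,
  `OrbitSpace.finrank_cohomology_orbitSpace_eq`), the order-`3` twin of
  `seven_mul_finrank_ker_sub_one_eq`; for `b₁(C) = 86`: `dim H¹(C)^τ = 30 = b₁(C/τ)`, `g(C/τ) = 15`;
* §3 (the Jacobian and the Prym) **`dim_kerComponent_id_sub_eq_twelve_of_isIso`**: `dim P' = 12`
  for `P' = (ker(𝟙_B - t_B))⁰ ⊂ B = (ker Σ_{i<7} sⁱ)⁰ ⊂ J(C)`, `dim J(C) = 43`: on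
  `V = H¹(J(ℂ); ℂ) ≅ H¹(C(ℂ); ℂ)` (the named fact) `dim V^S = 14` and `dim V^T = 30` (§2 for `σ` and
  `τ`), hence `dim (V^S ∩ V^T) = 6` (§1; `= b₁(C/F₂₁)`, `g(C/F₂₁) = 3`); the restriction
  `ι_B^* : V ↠ H¹(B)` is onto (`complexBetti_map_one_surjective_of_isClosedImmersion`) with kernel
  `V^S` (it contains `V^S = im (Σ Sⁱ)` as `ι_B ≫ e_N = 0`, and `dim H¹(B) = 2 dim B = 72`,
  `dim_kerComponent_normElement_eq_thirtySix_of_isIso`), so `dim H¹(B)^{t_B} = 30 - 6 = 24`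
  (§1), and `2 dim P' = dim ker((𝟙 - t_B)^* | H¹(B)) = 24` (`two_mul_dim_kerComponent_eq_finrank_ker`);
* §4 **`exists_heckePrymDatum_F21_of_isIso_of_weilType`**: the named fact from
  `isIso_bettiCohomology_map_abelJacobi` and [an étale `F₂₁`-curve with a Jacobian of dimension
  `43` whose Hecke–Prym `(P', φ')` is of Weil TYPE `(6, 6)`] — the residue being Riemann's
  existence theorem for `F₂₁` ([LangeRodriguez2022, Thm. 3.1.1]), the Jacobian
  (`Motives.nonempty_jacobian_of_isSmoothProjective`, `Motives.two_mul_dim_eq_finrank_bettiCohomology`)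
  and the HOLOMORPHIC Chevalley–Weil multiplicity `dim H^{1,0}(P')_{i√7} = 6`
  ([ChevalleyWeil1934Integrale]).

Everything is proved; no definition, no named fact (D-0026).

## References

* [LangeRodriguez2022] H. Lange, R. E. Rodríguez, *Decomposition of Jacobians by Prym Varieties*,
  LNM 2310 (2022): Thm. 3.1.1 (PDF p. 52), §3.2 (3.5)–(3.6) (PDF p. 56), §3.5 Cor. 3.5.9–3.5.10
  (PDF pp. 70–71).
* [Bredon1972] G. E. Bredon, *Introduction to Compact Transformation Groups* (1972), Ch. III Thm. 7.10.
* [HatcherAT2002] A. Hatcher, *Algebraic Topology* (2002), §3.G Prop. 3G.1.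
* [SerreLinearRepresentations1977] J.-P. Serre, *Linear Representations of Finite Groups*, §2.3.
* [Lange2023AbelianVarietiesC] H. Lange, *Abelian Varieties over the Complex Numbers* (2023), §4.1.1,
  Lemma 4.4.1, §4.5.2.
-/

noncomputable section

open CategoryTheory

namespace Literature.AlgebraicGeometry.HodgeTheory

open Literature.AlgebraicTopology.SingularHomology
open Literature.AlgebraicGeometry Literature.AlgebraicGeometry.Motives

universe u

/-! ### §1 Linear algebra: invariants of `F₂₁ = ⟨S, T | S⁷ = T³ = 1, ST = TS²⟩` and of quotients -/

section LinearAlgebra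

variable {V : Type*} [AddCommGroup V] [Module ℂ V]

/-! #### Invariants pass to equivariant quotients -/

/-- **Invariants are exact (characteristic `0`)**: for a surjection `I : V ↠ H` intertwining
`T` on `V` (`Tᵐ = 1`, `m ≠ 0`) with `T_H` on `H` (`I ∘ T = T_H ∘ I`), the fixed space of `T_H` is
the image of the fixed space of `T` (averaging `(1/m) Σ_{j<m} Tʲ` lifts invariants), whose kernel
is `V^T ∩ ker I`; hence `dim H^{T_H} + dim (V^T ∩ ker I) = dim V^T`.
[cite: SerreLinearRepresentations1977, §2.3 (projection onto invariants)] -/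
theorem finrank_ker_sub_one_add_finrank_inf_eq [FiniteDimensional ℂ V] {H : Type*} [AddCommGroup H]
    [Module ℂ H] (T : Module.End ℂ V) (TH : Module.End ℂ H) (I : V →ₗ[ℂ] H)
    (hI : Function.Surjective I) (hcomm : I ∘ₗ T = TH ∘ₗ I) {m : ℕ} (hT : T ^ m = 1) (hm : m ≠ 0) :
    Module.finrank ℂ (LinearMap.ker (TH - 1)) +
        Module.finrank ℂ ↥(LinearMap.ker (T - 1) ⊓ LinearMap.ker I) =
      Module.finrank ℂ (LinearMap.ker (T - 1)) := by
  -- the restriction of `I` to `V^T`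
  set F : LinearMap.ker (T - 1) →ₗ[ℂ] H := I ∘ₗ (LinearMap.ker (T - 1)).subtype with hF
  have hcommv : ∀ v, I (T v) = TH (I v) := fun v ↦ by
    simpa only [LinearMap.comp_apply] using LinearMap.congr_fun hcomm v
  have hpow : ∀ (j : ℕ) (v : V), I ((T ^ j) v) = (TH ^ j) (I v) := by
    intro j
    induction j with
    | zero => intro v; rfl
    | succ j ih => intro v; rw [pow_succ', pow_succ', Module.End.mul_apply, Module.End.mul_apply,
        hcommv, ih]
  -- its range is the fixed space of `T_H`
  have hrange : LinearMap.range F = LinearMap.ker (TH - 1) := by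
    ext h
    simp only [LinearMap.mem_range, LinearMap.mem_ker, LinearMap.sub_apply, Module.End.one_apply,
      sub_eq_zero, hF, LinearMap.comp_apply, Submodule.subtype_apply]
    constructor
    · rintro ⟨⟨v, hv⟩, rfl⟩
      rw [LinearMap.mem_ker, LinearMap.sub_apply, Module.End.one_apply, sub_eq_zero] at hv
      change TH (I v) = I v
      rw [← hcommv, hv]
    · intro hh
      obtain ⟨v, rfl⟩ := hI h
      -- average `v` over `⟨T⟩`
      have hfixH : ∀ j : ℕ, (TH ^ j) (I v) = I v := by
        intro j
        induction j with
        | zero => rfl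
        | succ j ih => rw [pow_succ', Module.End.mul_apply, ih, hh]
      set w : V := (m : ℂ)⁻¹ • ∑ j ∈ Finset.range m, (T ^ j) v with hw
      have hwfix : T w = w := by
        rw [hw, map_smul, map_sum]
        congr 1
        have := congrArg (fun B : Module.End ℂ V => B v) (sum_range_pow_succ_eq_of_pow_eq_one hT)
        simp only [LinearMap.sum_apply] at this
        rw [← this]
        exact Finset.sum_congr rfl fun j _ => by rw [pow_succ', Module.End.mul_apply]
      have hwmem : w ∈ LinearMap.ker (T - 1) := by
        rw [LinearMap.mem_ker, LinearMap.sub_apply, Module.End.one_apply, sub_eq_zero, hwfix]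
      refine ⟨⟨w, hwmem⟩, ?_⟩
      change I w = I v
      rw [hw, map_smul, map_sum, Finset.sum_congr rfl fun j _ => (hpow j v).trans (hfixH j),
        Finset.sum_const, Finset.card_range, ← Nat.cast_smul_eq_nsmul ℂ, smul_smul,
        inv_mul_cancel₀ (Nat.cast_ne_zero.2 hm), one_smul]
  -- its kernel is `V^T ∩ ker I`
  have hker : Module.finrank ℂ (LinearMap.ker F) =
      Module.finrank ℂ ↥(LinearMap.ker (T - 1) ⊓ LinearMap.ker I) := by
    have e1 : LinearMap.ker F = Submodule.comap (LinearMap.ker (T - 1)).subtype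
        (LinearMap.ker (T - 1) ⊓ LinearMap.ker I) := by
      rw [hF, LinearMap.ker_comp, Submodule.comap_inf, Submodule.comap_subtype_self, top_inf_eq]
    rw [e1]
    exact (Submodule.comapSubtypeEquivOfLe (inf_le_left : LinearMap.ker (T - 1) ⊓ LinearMap.ker I ≤ _)).finrank_eq
  have h := LinearMap.finrank_range_add_finrank_ker F
  rw [hrange, hker] at h
  exact h

/-! #### The group `F₂₁ = ⟨S, T⟩` of operators and the projector onto its invariants -/

variable {S T : Module.End ℂ V}

/-- `Sᵏ T = T S²ᵏ` from `S T = T S²`. [folklore] -/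
theorem pow_mul_eq_mul_pow_two_mul (hST : S * T = T * S ^ 2) (k : ℕ) :
    S ^ k * T = T * S ^ (2 * k) := by
  induction k with
  | zero => simp
  | succ k ih =>
    rw [pow_succ', mul_assoc, ih, ← mul_assoc, hST, mul_assoc, ← pow_add]
    congr 2
    ring

/-- `T Sᵏ = S⁴ᵏ T` from `S T = T S²` and `S⁷ = 1` (`4 = 2⁻¹ mod 7`). [folklore] -/
theorem mul_pow_eq_pow_four_mul_mul (hS : S ^ 7 = 1) (hST : S * T = T * S ^ 2) (k : ℕ) :
    T * S ^ k = S ^ (4 * k) * T := by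
  rw [pow_mul_eq_mul_pow_two_mul hST (4 * k)]
  congr 1
  rw [show 2 * (4 * k) = 7 * k + k by ring, pow_add, pow_mul, hS, one_pow, one_mul]

/-- `T² Sᵏ = S¹⁶ᵏ T²`. [folklore] -/
theorem sq_mul_pow_eq_pow_mul_sq (hS : S ^ 7 = 1) (hST : S * T = T * S ^ 2) (k : ℕ) :
    T ^ 2 * S ^ k = S ^ (16 * k) * T ^ 2 := by
  rw [pow_two, mul_assoc, mul_pow_eq_pow_four_mul_mul hS hST k, ← mul_assoc,
    mul_pow_eq_pow_four_mul_mul hS hST (4 * k), mul_assoc]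
  congr 2
  ring

/-- `tr(Sⁿ⁺¹ T) = tr(Sⁿ T)`: conjugation by `S²` (`S² (Sⁿ T) S⁵ = Sⁿ⁺²² T = Sⁿ⁺¹ T`).
[folklore] -/
theorem trace_pow_succ_mul_eq [FiniteDimensional ℂ V] (hS : S ^ 7 = 1) (hST : S * T = T * S ^ 2)
    (n : ℕ) :
    LinearMap.trace ℂ V (S ^ (n + 1) * T) = LinearMap.trace ℂ V (S ^ n * T) := by
  have key : S ^ 2 * (S ^ n * T) * S ^ 5 = S ^ (n + 1) * T := by
    rw [mul_assoc, mul_assoc, mul_pow_eq_pow_four_mul_mul hS hST 5, ← mul_assoc, ← mul_assoc,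
      ← pow_add, ← pow_add]
    congr 1
    rw [show 2 + n + 4 * 5 = (n + 1) + 7 * 3 by ring, pow_add, pow_mul, hS, one_pow, mul_one]
  rw [← key, LinearMap.trace_mul_comm, ← mul_assoc, ← mul_assoc, ← pow_add,
    show 5 + 2 = 7 from rfl, hS, one_mul]

/-- **`tr(Sⁿ T) = tr(T)` for all `n`** (the `σⁿτ` are conjugate to `τ` under `⟨σ⟩`). [folklore] -/
theorem trace_pow_mul_eq [FiniteDimensional ℂ V] (hS : S ^ 7 = 1) (hST : S * T = T * S ^ 2)
    (n : ℕ) : LinearMap.trace ℂ V (S ^ n * T) = LinearMap.trace ℂ V T := by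
  induction n with
  | zero => rw [pow_zero, one_mul]
  | succ n ih => rw [trace_pow_succ_mul_eq hS hST, ih]

/-- `tr(Sⁿ⁺¹ T²) = tr(Sⁿ T²)`: conjugation by `S⁶` (`S⁶ (Sⁿ T²) S = Sⁿ⁺²² T² = Sⁿ⁺¹ T²`).
[folklore] -/
theorem trace_pow_succ_mul_sq_eq [FiniteDimensional ℂ V] (hS : S ^ 7 = 1)
    (hST : S * T = T * S ^ 2) (n : ℕ) :
    LinearMap.trace ℂ V (S ^ (n + 1) * T ^ 2) = LinearMap.trace ℂ V (S ^ n * T ^ 2) := by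
  have key : S ^ 6 * (S ^ n * T ^ 2) * S ^ 1 = S ^ (n + 1) * T ^ 2 := by
    rw [mul_assoc, mul_assoc, sq_mul_pow_eq_pow_mul_sq hS hST 1, ← mul_assoc, ← mul_assoc,
      ← pow_add, ← pow_add]
    congr 1
    rw [show 6 + n + 16 * 1 = (n + 1) + 7 * 3 by ring, pow_add, pow_mul, hS, one_pow, mul_one]
  rw [← key, LinearMap.trace_mul_comm, ← mul_assoc, ← mul_assoc, ← pow_add,
    show 1 + 6 = 7 from rfl, hS, one_mul]

/-- **`tr(Sⁿ T²) = tr(T²)` for all `n`**. [folklore] -/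
theorem trace_pow_mul_sq_eq [FiniteDimensional ℂ V] (hS : S ^ 7 = 1) (hST : S * T = T * S ^ 2)
    (n : ℕ) : LinearMap.trace ℂ V (S ^ n * T ^ 2) = LinearMap.trace ℂ V (T ^ 2) := by
  induction n with
  | zero => rw [pow_zero, one_mul]
  | succ n ih => rw [trace_pow_succ_mul_sq_eq hS hST, ih]

/-- Powers of `S` depend only on the exponent mod `7`. [folklore] -/
theorem pow_eq_pow_mod_seven (hS : S ^ 7 = 1) (n : ℕ) : S ^ n = S ^ (n % 7) :=
  pow_eq_pow_mod n hS

/-- `Σ_{i<7} S⁴ⁱ = Σ_{i<7} Sⁱ` (`i ↦ 4i` permutes `ℤ/7`). [folklore] -/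
theorem sum_range_pow_four_mul_eq (hS : S ^ 7 = 1) :
    ∑ i ∈ Finset.range 7, S ^ (4 * i) = ∑ i ∈ Finset.range 7, S ^ i := by
  simp only [Finset.sum_range_succ, Finset.sum_range_zero, zero_add]
  rw [pow_eq_pow_mod_seven hS (4 * 2), pow_eq_pow_mod_seven hS (4 * 3),
    pow_eq_pow_mod_seven hS (4 * 4), pow_eq_pow_mod_seven hS (4 * 5),
    pow_eq_pow_mod_seven hS (4 * 6)]
  norm_num
  abel

/-- `T` commutes with the norm element `Σ_{i<7} Sⁱ`. [folklore] -/
theorem mul_sum_range_pow_eq (hS : S ^ 7 = 1) (hST : S * T = T * S ^ 2) :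
    T * ∑ i ∈ Finset.range 7, S ^ i = (∑ i ∈ Finset.range 7, S ^ i) * T := by
  calc T * ∑ i ∈ Finset.range 7, S ^ i = ∑ i ∈ Finset.range 7, T * S ^ i := Finset.mul_sum _ _ _
    _ = ∑ i ∈ Finset.range 7, S ^ (4 * i) * T :=
        Finset.sum_congr rfl fun i _ ↦ mul_pow_eq_pow_four_mul_mul hS hST i
    _ = (∑ i ∈ Finset.range 7, S ^ (4 * i)) * T := (Finset.sum_mul _ _ _).symm
    _ = (∑ i ∈ Finset.range 7, S ^ i) * T := by rw [sum_range_pow_four_mul_eq hS]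

/-- `A · Σ_{j<m} Aʲ = Σ_{j<m} Aʲ` for `Aᵐ = 1`. [folklore] -/
theorem mul_sum_range_pow_eq_of_pow_eq_one {A : Module.End ℂ V} {m : ℕ} (hA : A ^ m = 1) :
    A * ∑ j ∈ Finset.range m, A ^ j = ∑ j ∈ Finset.range m, A ^ j := by
  rw [Finset.mul_sum, ← sum_range_pow_succ_eq_of_pow_eq_one hA]
  exact Finset.sum_congr rfl fun j _ ↦ by rw [pow_succ']

/-- **The projector onto the `F₂₁`-invariants** (Serre §2.3, `(1/|G|) Σ_g g`):
`(1/21) (Σ_{i<7} Sⁱ)(Σ_{j<3} Tʲ)` is a projection onto `V^S ∩ V^T`.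
[cite: SerreLinearRepresentations1977, §2.3] -/
theorem isProj_inf_of_F21 (hS : S ^ 7 = 1) (hT : T ^ 3 = 1) (hST : S * T = T * S ^ 2) :
    LinearMap.IsProj (LinearMap.ker (S - 1) ⊓ LinearMap.ker (T - 1))
      ((21 : ℂ)⁻¹ • ((∑ i ∈ Finset.range 7, S ^ i) * ∑ j ∈ Finset.range 3, T ^ j)) := by
  set eS : Module.End ℂ V := ∑ i ∈ Finset.range 7, S ^ i with heS
  set eT : Module.End ℂ V := ∑ j ∈ Finset.range 3, T ^ j with heT
  have hSe : S * eS = eS := mul_sum_range_pow_eq_of_pow_eq_one hS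
  have hTe : T * eT = eT := mul_sum_range_pow_eq_of_pow_eq_one hT
  have hTeS : T * eS = eS * T := mul_sum_range_pow_eq hS hST
  constructor
  · intro v
    rw [Submodule.mem_inf]
    refine ⟨?_, ?_⟩
    · rw [LinearMap.mem_ker, LinearMap.sub_apply, Module.End.one_apply, sub_eq_zero,
        LinearMap.smul_apply, map_smul, ← Module.End.mul_apply, ← mul_assoc, hSe]
    · rw [LinearMap.mem_ker, LinearMap.sub_apply, Module.End.one_apply, sub_eq_zero,
        LinearMap.smul_apply, map_smul, ← Module.End.mul_apply, ← mul_assoc, hTeS, mul_assoc, hTe]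
  · intro v hv
    rw [Submodule.mem_inf] at hv
    obtain ⟨hvS, hvT⟩ := hv
    rw [LinearMap.mem_ker, LinearMap.sub_apply, Module.End.one_apply, sub_eq_zero] at hvS hvT
    have hSj : ∀ j : ℕ, (S ^ j) v = v := by
      intro j; induction j with
      | zero => rfl
      | succ j ih => rw [pow_succ, Module.End.mul_apply, hvS, ih]
    have hTj : ∀ j : ℕ, (T ^ j) v = v := by
      intro j; induction j with
      | zero => rfl
      | succ j ih => rw [pow_succ, Module.End.mul_apply, hvT, ih]
    have h1 : eT v = (3 : ℂ) • v := by
      rw [heT, LinearMap.sum_apply, Finset.sum_congr rfl fun j _ => hTj j, Finset.sum_const,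
        Finset.card_range, ← Nat.cast_smul_eq_nsmul ℂ]
      norm_num
    have h2 : eS v = (7 : ℂ) • v := by
      rw [heS, LinearMap.sum_apply, Finset.sum_congr rfl fun j _ => hSj j, Finset.sum_const,
        Finset.card_range, ← Nat.cast_smul_eq_nsmul ℂ]
      norm_num
    rw [LinearMap.smul_apply, Module.End.mul_apply, h1, map_smul, h2, smul_smul, smul_smul]
    norm_num

/-- **`21 · dim (V^S ∩ V^T) = Σ_{i<7} Σ_{j<3} tr(Sⁱ Tʲ)`** (trace of the projector).
[cite: SerreLinearRepresentations1977, §2.3] -/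
theorem twentyOne_mul_finrank_inf_eq_sum_trace [FiniteDimensional ℂ V] (hS : S ^ 7 = 1)
    (hT : T ^ 3 = 1) (hST : S * T = T * S ^ 2) :
    (21 : ℂ) * Module.finrank ℂ ↥(LinearMap.ker (S - 1) ⊓ LinearMap.ker (T - 1)) =
      ∑ i ∈ Finset.range 7, ∑ j ∈ Finset.range 3, LinearMap.trace ℂ V (S ^ i * T ^ j) := by
  have htr := (isProj_inf_of_F21 hS hT hST).trace
  rw [map_smul, Finset.sum_mul_sum, map_sum, smul_eq_mul] at htr
  rw [← htr, ← mul_assoc, mul_inv_cancel₀ (by norm_num : (21 : ℂ) ≠ 0), one_mul]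
  exact Finset.sum_congr rfl fun i _ ↦ map_sum _ _ _

/-- **The `F₂₁`-count: `21 · dim (V^S ∩ V^T) + 7 · dim V = 7 · dim V^S + 21 · dim V^T`** for
operators `S⁷ = 1`, `T³ = 1`, `ST = TS²` on a finite-dimensional complex vector space
(`Σ_{i,j} tr(SⁱTʲ) = Σ_i tr Sⁱ + 7 tr T + 7 tr T²`, `Σ_i tr Sⁱ = 7 dim V^S`,
`dim V + tr T + tr T² = 3 dim V^T`). For `H¹` of the `F₂₁`-curve of genus `43`
(`dim V = 86`, `dim V^S = 14`, `dim V^T = 30`) this gives `dim V^{F₂₁} = 6 = b₁` of the genus-3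
quotient. [cite: SerreLinearRepresentations1977, §2.3] -/
theorem twentyOne_mul_finrank_inf_add [FiniteDimensional ℂ V] (hS : S ^ 7 = 1) (hT : T ^ 3 = 1)
    (hST : S * T = T * S ^ 2) :
    21 * Module.finrank ℂ ↥(LinearMap.ker (S - 1) ⊓ LinearMap.ker (T - 1)) +
        7 * Module.finrank ℂ V =
      7 * Module.finrank ℂ (LinearMap.ker (S - 1)) + 21 * Module.finrank ℂ (LinearMap.ker (T - 1)) := by
  have h21 := twentyOne_mul_finrank_inf_eq_sum_trace hS hT hST
  have h7 := card_mul_finrank_ker_eq_sum_trace_pow S hS (by norm_num : ((7 : ℕ) : ℂ) ≠ 0)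
  have h3 := card_mul_finrank_ker_eq_sum_trace_pow T hT (by norm_num : ((3 : ℕ) : ℂ) ≠ 0)
  -- expand the inner sums over `j < 3` and use the trace identities
  have hinner : ∀ i : ℕ, ∑ j ∈ Finset.range 3, LinearMap.trace ℂ V (S ^ i * T ^ j) =
      LinearMap.trace ℂ V (S ^ i) + LinearMap.trace ℂ V T + LinearMap.trace ℂ V (T ^ 2) := by
    intro i
    simp only [Finset.sum_range_succ, Finset.sum_range_zero, zero_add, pow_zero, mul_one, pow_one]
    rw [trace_pow_mul_eq hS hST, trace_pow_mul_sq_eq hS hST]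
  simp only [hinner, Finset.sum_add_distrib, Finset.sum_const, Finset.card_range, nsmul_eq_mul] at h21
  simp only [Finset.sum_range_succ, Finset.sum_range_zero, zero_add, pow_zero, pow_one,
    LinearMap.trace_one] at h3
  push_cast at h7 h3 h21
  have key : (21 : ℂ) * Module.finrank ℂ ↥(LinearMap.ker (S - 1) ⊓ LinearMap.ker (T - 1)) +
      7 * Module.finrank ℂ V =
      7 * Module.finrank ℂ (LinearMap.ker (S - 1)) + 21 * Module.finrank ℂ (LinearMap.ker (T - 1)) := by
    linear_combination h21 - h7 - 7 * h3
  exact_mod_cast key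

end LinearAlgebra

/-! ### §2 The curve: `3 · dim H¹(C)^τ = 4 + b₁(C)` for a free automorphism of order `3` -/

section Curve

variable {C : Motives.SchemeOver ℂ}

/-- **`τ^* = 1` on the line `H²(C(ℂ); ℂ)`** for an automorphism `τ` with `τ³ = 𝟙` of a smooth
projective curve: the trace `l` of `τ^*` on `H²` is rational (`trace_complexBetti_map_mem_range_ratCast`)
with `l³ = 1`, hence `l = 1`, and an endomorphism of a line is its trace. [folklore] -/
theorem complexBetti_map_two_hom_eq_one_of_pow_three (hC : Motives.IsSmoothProjective 1 C) (τ : C ⟶ C)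
    (hτ : τ ≫ τ ≫ τ = 𝟙 C) : (complexBetti.map τ 2).hom = 1 := by
  haveI := finite_complexBetti_of_isSmoothProjective hC 2
  have h1 := finrank_complexBetti_two_of_curve hC
  set l := LinearMap.trace ℂ _ (complexBetti.map τ 2).hom with hl
  have h3 : l ^ 3 = 1 := by
    rw [hl, ← trace_pow_of_finrank_eq_one h1]
    have e : (complexBetti.map τ 2).hom ^ 3 = (complexBetti.map (τ ≫ τ ≫ τ) 2).hom := by
      simp only [complexBetti_map_comp_hom', pow_succ, pow_zero, Module.End.one_eq_id,
        LinearMap.id_comp, Module.End.mul_eq_comp, LinearMap.comp_assoc]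
    rw [e, hτ, complexBetti.map_id, ModuleCat.hom_id, ← Module.End.one_eq_id, LinearMap.trace_one, h1,
      Nat.cast_one]
  obtain ⟨r, hr⟩ := trace_complexBetti_map_mem_range_ratCast hC τ 2
  rw [← hl] at hr
  have hr3 : r ^ 3 = 1 := by exact_mod_cast (show ((r : ℂ)) ^ 3 = 1 by rw [hr, h3])
  have hr1 : r = 1 := (Odd.strictMono_pow (by decide : Odd 3)).injective (by rw [hr3, one_pow])
  have hl1 : l = 1 := by rw [← hr, hr1, Rat.cast_one]
  rw [eq_trace_smul_one_of_finrank_eq_one h1 (complexBetti.map τ 2).hom, ← hl, hl1, one_smul]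

/-- **Riemann–Hurwitz for the étale `ℤ/3`-quotient, cohomologically**: for a smooth projective complex
curve `C` and an automorphism `τ` with `τ³ = 𝟙` without fixed complex points,
`3 · dim ker(τ^* - 1 | H¹(C(ℂ); ℂ)) = 4 + dim H¹(C(ℂ); ℂ)` (for `g(C) = 43`: `dim H¹(C)^τ = 30 =
b₁(C/τ)`, `g(C/τ) = 15`).  Proof on the closed surface `C(ℂ)`: `χ(C) = 3·χ(C/⟨τ⟩)` (Smith theory,
`OrbitSpace.euler_eq_prime_mul_euler`) and `H^k(C/⟨τ⟩; ℂ) = H^k(C; ℂ)^τ` (transfer,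
`OrbitSpace.finrank_cohomology_orbitSpace_eq`), with `τ^* = 1` on `H⁰` and `H²`; the order-`3` twin
of `seven_mul_finrank_ker_sub_one_eq`. [cite: Bredon1972, Ch. III Thm. 7.10]
[cite: HatcherAT2002, §3.G Prop. 3G.1] [cite: LangeRodriguez2022, §3.2 (3.6) (PDF p. 56)] -/
theorem three_mul_finrank_ker_sub_one_eq (hC : Motives.IsSmoothProjective 1 C) (τ : C ⟶ C)
    (hτ : τ ≫ τ ≫ τ = 𝟙 C) (hfree : ∀ P : Motives.ComplexPoints C, P ≫ τ ≠ P) :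
    3 * Module.finrank ℂ (LinearMap.ker ((complexBetti.map τ 1).hom - 1)) =
      4 + Module.finrank ℂ (complexBetti C 1) := by
  letI := hC.chartedSpace
  haveI := Motives.ComplexPoints.compactSpace_of_isSmoothProjective hC
  haveI := Motives.ComplexPoints.t2Space_of_isSmoothProjective hC
  haveI : Nonempty (Motives.ComplexPoints C) := Motives.nonempty_algPoints_of_isSmoothProjective hC
  haveI : Fact (Nat.Prime 3) := ⟨by norm_num⟩
  haveI h0fin := finite_complexBetti_of_isSmoothProjective hC 0
  haveI h1fin := finite_complexBetti_of_isSmoothProjective hC 1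
  haveI h2fin := finite_complexBetti_of_isSmoothProjective hC 2
  -- the homeomorphism `a = τ(ℂ)` of the closed surface `C(ℂ)`, of order `3`, acting freely
  let a : Motives.ComplexPoints C ≃ₜ Motives.ComplexPoints C :=
    { toFun := Motives.AlgPoints.mapContinuous (L := ℂ) τ
      invFun := Motives.AlgPoints.mapContinuous (L := ℂ) (τ ≫ τ)
      left_inv := fun x => by
        change Motives.AlgPoints.map (τ ≫ τ) (Motives.AlgPoints.map τ x) = x
        rw [← Motives.AlgPoints.map_comp_apply, hτ, Motives.AlgPoints.map_id_apply]
      right_inv := fun x => by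
        change Motives.AlgPoints.map τ (Motives.AlgPoints.map (τ ≫ τ) x) = x
        rw [← Motives.AlgPoints.map_comp_apply]
        simp only [Category.assoc]
        rw [hτ, Motives.AlgPoints.map_id_apply]
      continuous_toFun := (Motives.AlgPoints.mapContinuous (L := ℂ) τ).continuous
      continuous_invFun := (Motives.AlgPoints.mapContinuous (L := ℂ) (τ ≫ τ)).continuous }
  have ha1 : ∀ x, (a ^ 1) x = Motives.AlgPoints.map τ x := fun x => by rw [pow_one]; rfl
  have ha2 : ∀ x, (a ^ 2) x = Motives.AlgPoints.map (τ ≫ τ) x := fun x => by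
    rw [pow_succ, Homeomorph.mul_apply, Motives.AlgPoints.map_comp_apply, ha1]
    rfl
  have ha3 : a ^ 3 = 1 := by
    refine Homeomorph.ext fun x => ?_
    rw [pow_succ, Homeomorph.mul_apply, ha2, Homeomorph.one_apply]
    change Motives.AlgPoints.map (τ ≫ τ) (Motives.AlgPoints.map τ x) = x
    rw [← Motives.AlgPoints.map_comp_apply, hτ, Motives.AlgPoints.map_id_apply]
  -- `τ²` is free as well: a fixed point of `τ²` is fixed by `τ⁴ = τ`
  have hfree2 : ∀ P : Motives.ComplexPoints C, P ≫ τ ≫ τ ≠ P := by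
    intro P h2
    apply hfree P
    have h4 : P ≫ τ ≫ τ ≫ τ ≫ τ = P := by
      rw [reassoc_of% h2, h2]
    calc P ≫ τ = P ≫ (τ ≫ τ ≫ τ) ≫ τ := by rw [hτ, Category.id_comp]
      _ = P := by simpa only [Category.assoc] using h4
  have hfree3 : ∀ i : ℕ, 0 < i → i < 3 → ∀ x : Motives.ComplexPoints C, (a ^ i) x ≠ x := by
    intro i hi0 hi3 x
    interval_cases i
    · rw [ha1]; exact hfree x
    · rw [ha2]; exact hfree2 x
  -- Smith theory + transfer on the closed surface
  have hE := OrbitSpace.euler_eq_prime_mul_euler (n := 2 * 1) a ha3 hfree3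
  have hk := fun k => OrbitSpace.finrank_cohomology_orbitSpace_eq a ha3 hfree3 k
  simp only [show 2 * 1 + 1 = 3 from rfl, Finset.sum_range_succ, Finset.sum_range_zero, zero_add] at hE
  -- `τ^* = 1` on `H⁰` and on `H²`: the fixed spaces there are everything, of dimension `1`
  have hK0 : Module.finrank ℂ (LinearMap.ker ((complexBetti.map τ 0).hom - 1)) = 1 := by
    rw [complexBetti_map_zero_hom_eq_id hC τ, ← Module.End.one_eq_id, sub_self, LinearMap.ker_zero,
      finrank_top, finrank_complexBetti_zero hC]
  have hK2 : Module.finrank ℂ (LinearMap.ker ((complexBetti.map τ 2).hom - 1)) = 1 := by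
    rw [complexBetti_map_two_hom_eq_one_of_pow_three hC τ hτ, sub_self, LinearMap.ker_zero, finrank_top,
      finrank_complexBetti_two_of_curve hC]
  have hq0 : Module.finrank ℂ (singularCohomology ℂ ℂ (OrbitSpace a) 0) = 1 := (hk 0).trans hK0
  have hq2 : Module.finrank ℂ (singularCohomology ℂ ℂ (OrbitSpace a) 2) = 1 := (hk 2).trans hK2
  have hq1 : Module.finrank ℂ (singularCohomology ℂ ℂ (OrbitSpace a) 1) =
      Module.finrank ℂ (LinearMap.ker ((complexBetti.map τ 1).hom - 1)) := hk 1
  have hc0 : Module.finrank ℂ (singularCohomology ℂ ℂ (Motives.ComplexPoints C) 0) = 1 :=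
    finrank_complexBetti_zero hC
  have hc2 : Module.finrank ℂ (singularCohomology ℂ ℂ (Motives.ComplexPoints C) 2) = 1 :=
    finrank_complexBetti_two_of_curve hC
  have hc1 : Module.finrank ℂ (singularCohomology ℂ ℂ (Motives.ComplexPoints C) 1) =
      Module.finrank ℂ (complexBetti C 1) := rfl
  rw [hq0, hq1, hq2, hc0, hc1, hc2] at hE
  push_cast at hE
  have key : 3 * (Module.finrank ℂ (LinearMap.ker ((complexBetti.map τ 1).hom - 1)) : ℤ) =
      4 + (Module.finrank ℂ (complexBetti C 1) : ℤ) := by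
    linarith
  exact_mod_cast key

end Curve

/-! ### §3 The Jacobian and the Prym: `dim P' = 12` from `H¹(J) ≅ H¹(C)` -/

section JacobianSide

variable {C : Motives.SchemeOver ℂ} (𝒥 : Jacobian C)

/-- `(f ≫ g)^* = f^* ∘ g^*` on `H¹` of abelian varieties, `Module.End` form. [folklore] -/
theorem complexBetti_map_comp_one_hom_eq_mul {A : Motives.AbelianVariety ℂ} (f g : A ⟶ A) :
    (complexBetti.map (f ≫ g).hom.hom.hom 1).hom =
      (complexBetti.map f.hom.hom.hom 1).hom * (complexBetti.map g.hom.hom.hom 1).hom := by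
  change (complexBetti.map (f.hom.hom.hom ≫ g.hom.hom.hom) 1).hom = _
  rw [complexBetti.map_comp, ModuleCat.hom_comp, Module.End.mul_eq_comp]

/-- **Chevalley–Weil for the Hecke–Prym of an étale `F₂₁`-cover: `dim P' = 12`**, from
`H¹(J) ≅ H¹(C)` (the named fact `Motives.isIso_bettiCohomology_map_abelJacobi`). For a smooth
projective complex curve `C` with a Jacobian `𝒥` of dimension `43` and fixed-point-free
automorphisms `σ⁷ = 𝟙`, `τ³ = 𝟙`, `σ ≫ τ = τ ≫ σ ≫ σ`, with `s = σ_*`, `t = τ_*`,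
`e_N = Σ_{i<7} sⁱ`, `B = (ker e_N)⁰` and any `t_B` over `t`: the fixed component
`P' = (ker(𝟙_B - t_B))⁰` has dimension `12` ("`H¹(P') = H¹(B)^τ` has dimension `24`",
[LangeRodriguez2022, §3.2 (3.6), §3.5 Cor. 3.5.9–3.5.10]). Proof (module docstring, §3): on
`V = H¹(J(ℂ); ℂ)`, `dim V^S = 14`, `dim V^T = 30` (Smith theory on `C(ℂ)` for `σ` and `τ`,
transported along `(f^P)^*`), `dim (V^S ∩ V^T) = 6` (`twentyOne_mul_finrank_inf_add`),
`ι_B^* : V ↠ H¹(B)` is onto with kernel `V^S`, so `dim H¹(B)^{t_B} = 24 = 2 dim P'`.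
[cite: LangeRodriguez2022, §3.2 (3.5)–(3.6) (PDF p. 56) and §3.5 Cor. 3.5.9–3.5.10 (PDF pp. 70–71)]
[cite: Lange2023AbelianVarietiesC, §4.1.1 and Lemma 4.4.1] -/
theorem dim_kerComponent_id_sub_eq_twelve_of_isIso
    (hI : Motives.isIso_bettiCohomology_map_abelJacobi) {σ τ : C ⟶ C}
    (hC : Motives.IsSmoothProjective 1 C) (h43 : 𝒥.J.dim = 43)
    (hσ : σ ≫ σ ≫ σ ≫ σ ≫ σ ≫ σ ≫ σ = 𝟙 C) (hτ : τ ≫ τ ≫ τ = 𝟙 C) (hστ : σ ≫ τ = τ ≫ σ ≫ σ)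
    (hfree : ∀ P : Motives.ComplexPoints C, P ≫ σ ≠ P ∧ P ≫ τ ≠ P)
    {s t eN : 𝒥.J ⟶ 𝒥.J} (hs : s = 𝒥.pushforward 𝒥 σ) (ht : t = 𝒥.pushforward 𝒥 τ)
    (heN : eN = 𝟙 𝒥.J + s + s ≫ s + s ≫ s ≫ s + s ≫ s ≫ s ≫ s + s ≫ s ≫ s ≫ s ≫ s +
      s ≫ s ≫ s ≫ s ≫ s ≫ s)
    {tB : Motives.AbelianVariety.kerComponent eN ⟶ Motives.AbelianVariety.kerComponent eN}
    (htB : tB ≫ Motives.AbelianVariety.kerComponentι eN = Motives.AbelianVariety.kerComponentι eN ≫ t) :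
    (Motives.AbelianVariety.kerComponent
      (𝟙 (Motives.AbelianVariety.kerComponent eN) - tB)).dim = 12 := by
  haveI := finite_complexBetti_abelianVariety 𝒥.J 1
  haveI := finite_complexBetti_abelianVariety (Motives.AbelianVariety.kerComponent eN) 1
  haveI := finite_complexBetti_of_isSmoothProjective hC 1
  set S : Module.End ℂ (complexBetti 𝒥.J.X 1) := (complexBetti.map s.hom.hom.hom 1).hom with hSdef
  set T : Module.End ℂ (complexBetti 𝒥.J.X 1) := (complexBetti.map t.hom.hom.hom 1).hom with hTdef
  set I : complexBetti 𝒥.J.X 1 →ₗ[ℂ] complexBetti (Motives.AbelianVariety.kerComponent eN).X 1 :=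
    (complexBetti.map (Motives.AbelianVariety.kerComponentι eN).hom.hom.hom 1).hom with hIdef
  set TB : Module.End ℂ (complexBetti (Motives.AbelianVariety.kerComponent eN).X 1) :=
    (complexBetti.map tB.hom.hom.hom 1).hom with hTBdef
  -- the relations `S⁷ = 1`, `T³ = 1`, `S T = T S²`
  have hS7 : S ^ 7 = 1 :=
    complexBetti_map_one_hom_pow_seven (pushforward_comp_pow_seven_of_pow_seven 𝒥 hσ hs)
  have ht3 : t ≫ t ≫ t = 𝟙 𝒥.J := by
    simp only [ht, ← Jacobian.pushforward_comp, hτ, Jacobian.pushforward_id]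
  have hT3 : T ^ 3 = 1 := complexBetti_map_one_hom_pow_three ht3
  have hst : s ≫ t = t ≫ s ≫ s := by
    simp only [hs, ht, ← Jacobian.pushforward_comp, hστ]
  have hST : S * T = T * S ^ 2 := by
    have h := congrArg (fun u : 𝒥.J ⟶ 𝒥.J => (complexBetti.map u.hom.hom.hom 1).hom) hst
    dsimp only at h
    rw [complexBetti_map_comp_one_hom_eq_mul, complexBetti_map_comp_one_hom_eq_mul,
      complexBetti_map_comp_one_hom_eq_mul] at h
    rw [hSdef, hTdef, h, pow_two]
  -- `dim H¹(J) = dim H¹(C) = 86`, through the bijection `(f^P)^*`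
  obtain ⟨P⟩ : Nonempty (Motives.AlgPoints C ℂ) := Motives.nonempty_algPoints_of_isSmoothProjective hC
  have hbij := bijective_complexBetti_map_abelJacobi 𝒥 hI hC P
  have h86 : Module.finrank ℂ (complexBetti 𝒥.J.X 1) = 86 := by
    rw [Motives.AbelianVariety.finrank_complexBetti_one, h43]
  have hbC : Module.finrank ℂ (complexBetti C 1) = 86 := by
    rw [← h86]
    exact (LinearEquiv.ofBijective (complexBetti.map (𝒥.abelJacobi P) 1).hom hbij).finrank_eq.symm
  -- `dim V^S = 14`
  have hS14 : Module.finrank ℂ (LinearMap.ker (S - 1)) = 14 := by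
    have hsq := complexBetti_map_pushforward_comp_map_abelJacobi 𝒥 σ P 1
    rw [← hs] at hsq
    have hcomm : (complexBetti.map σ 1).hom ∘ₗ (complexBetti.map (𝒥.abelJacobi P) 1).hom =
        (complexBetti.map (𝒥.abelJacobi P) 1).hom ∘ₗ S := by
      rw [hSdef, ← ModuleCat.hom_comp, ← hsq, ModuleCat.hom_comp]
    have hfix := finrank_ker_sub_one_eq_of_comm (complexBetti.map σ 1).hom S
      (complexBetti.map (𝒥.abelJacobi P) 1).hom hbij.1 hcomm (fun v _ => hbij.2 v)
    have hcurve := seven_mul_finrank_ker_sub_one_eq hC σ hσ (fun Q => (hfree Q).1)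
    rw [hbC, ← hfix] at hcurve
    omega
  -- `dim V^T = 30`
  have hT30 : Module.finrank ℂ (LinearMap.ker (T - 1)) = 30 := by
    have hsq := complexBetti_map_pushforward_comp_map_abelJacobi 𝒥 τ P 1
    rw [← ht] at hsq
    have hcomm : (complexBetti.map τ 1).hom ∘ₗ (complexBetti.map (𝒥.abelJacobi P) 1).hom =
        (complexBetti.map (𝒥.abelJacobi P) 1).hom ∘ₗ T := by
      rw [hTdef, ← ModuleCat.hom_comp, ← hsq, ModuleCat.hom_comp]
    have hfix := finrank_ker_sub_one_eq_of_comm (complexBetti.map τ 1).hom T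
      (complexBetti.map (𝒥.abelJacobi P) 1).hom hbij.1 hcomm (fun v _ => hbij.2 v)
    have hcurve := three_mul_finrank_ker_sub_one_eq hC τ hτ (fun Q => (hfree Q).2)
    rw [hbC, ← hfix] at hcurve
    omega
  -- `dim (V^S ∩ V^T) = 6`
  have h6 : Module.finrank ℂ ↥(LinearMap.ker (S - 1) ⊓ LinearMap.ker (T - 1)) = 6 := by
    have h := twentyOne_mul_finrank_inf_add hS7 hT3 hST
    rw [h86, hS14, hT30] at h
    omega
  -- `ι_B^*` is onto, `H¹(B)` has dimension `72`
  have hIsurj : Function.Surjective I :=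
    complexBetti_map_one_surjective_of_isClosedImmersion (Motives.AbelianVariety.kerComponentι eN)
  have h72 : Module.finrank ℂ (complexBetti (Motives.AbelianVariety.kerComponent eN).X 1) = 72 := by
    rw [Motives.AbelianVariety.finrank_complexBetti_one,
      dim_kerComponent_normElement_eq_thirtySix_of_isIso 𝒥 hI σ hC h43 hσ (fun Q => (hfree Q).1) hs heN]
  -- `ker ι_B^* = V^S`
  have hkerI : LinearMap.ker I = LinearMap.ker (S - 1) := by
    symm
    apply Submodule.eq_of_le_of_finrank_eq
    · -- `V^S ≤ ker ι_B^*`: `ι_B^* ∘ e_N^* = 0` and `e_N^* v = 7 v` on `V^S`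
      intro v hv
      rw [LinearMap.mem_ker, LinearMap.sub_apply, Module.End.one_apply, sub_eq_zero] at hv
      have hSj : ∀ j : ℕ, (S ^ j) v = v := by
        intro j; induction j with
        | zero => rfl
        | succ j ih => rw [pow_succ, Module.End.mul_apply, hv, ih]
      have hN : (complexBetti.map eN.hom.hom.hom 1).hom v = (7 : ℂ) • v := by
        rw [heN, complexBetti_map_normElement₇_one_hom s, ← hSdef, LinearMap.sum_apply,
          Finset.sum_congr rfl fun j _ => hSj j, Finset.sum_const, Finset.card_range,
          ← Nat.cast_smul_eq_nsmul ℂ]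
        norm_num
      have hzero : I ((complexBetti.map eN.hom.hom.hom 1).hom v) = 0 := by
        have hc : (Motives.AbelianVariety.kerComponentι eN ≫ eN) = 0 :=
          Motives.AbelianVariety.kerComponentι_comp eN
        have h := congrArg (fun u : Motives.AbelianVariety.kerComponent eN ⟶ 𝒥.J =>
          (complexBetti.map u.hom.hom.hom 1).hom v) hc
        dsimp only at h
        rw [complexBetti_map_zero_one, ModuleCat.hom_zero, LinearMap.zero_apply] at h
        rw [← h, hIdef]
        change _ = (complexBetti.map ((Motives.AbelianVariety.kerComponentι eN).hom.hom.hom ≫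
          eN.hom.hom.hom) 1).hom v
        rw [complexBetti.map_comp, ModuleCat.hom_comp, LinearMap.comp_apply]
      rw [hN, map_smul, smul_eq_zero] at hzero
      rw [LinearMap.mem_ker]
      exact hzero.resolve_left (by norm_num)
    · -- dimensions: `dim ker ι_B^* = 86 - 72 = 14`
      have hr := LinearMap.finrank_range_add_finrank_ker I
      rw [LinearMap.range_eq_top.2 hIsurj, finrank_top, h72, h86] at hr
      rw [hS14]
      omega
  -- `ι_B^*` intertwines `T` with `T_B`
  have hcommI : I ∘ₗ T = TB ∘ₗ I := by
    have h := congrArg (fun u : Motives.AbelianVariety.kerComponent eN ⟶ 𝒥.J =>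
      (complexBetti.map u.hom.hom.hom 1).hom) htB
    dsimp only at h
    have e1 : (complexBetti.map (tB ≫ Motives.AbelianVariety.kerComponentι eN).hom.hom.hom 1).hom =
        TB ∘ₗ I := by
      change (complexBetti.map (tB.hom.hom.hom ≫
        (Motives.AbelianVariety.kerComponentι eN).hom.hom.hom) 1).hom = _
      rw [complexBetti.map_comp, ModuleCat.hom_comp]
    have e2 : (complexBetti.map (Motives.AbelianVariety.kerComponentι eN ≫ t).hom.hom.hom 1).hom =
        I ∘ₗ T := by
      change (complexBetti.map ((Motives.AbelianVariety.kerComponentι eN).hom.hom.hom ≫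
        t.hom.hom.hom) 1).hom = _
      rw [complexBetti.map_comp, ModuleCat.hom_comp]
    rw [e1, e2] at h
    exact h.symm
  -- `dim H¹(B)^{t_B} = 30 - 6 = 24`
  have h24 : Module.finrank ℂ (LinearMap.ker (TB - 1)) = 24 := by
    have h := finrank_ker_sub_one_add_finrank_inf_eq T TB I hIsurj hcommI hT3 (by norm_num)
    rw [hkerI, inf_comm, h6, hT30] at h
    omega
  -- `2 dim P' = dim ker((𝟙 - t_B)^*) = dim ker(1 - T_B) = 24`
  have hD := two_mul_dim_kerComponent_eq_finrank_ker (𝟙 (Motives.AbelianVariety.kerComponent eN) - tB)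
  have hmap : (complexBetti.map (𝟙 (Motives.AbelianVariety.kerComponent eN) - tB).hom.hom.hom 1).hom =
      -(TB - 1) := by
    rw [complexBetti_map_sub_one, ModuleCat.hom_sub, hTBdef, neg_sub]
    congr 1
    change (complexBetti.map (𝟙 (Motives.AbelianVariety.kerComponent eN).X) 1).hom = 1
    rw [complexBetti.map_id, ModuleCat.hom_id, Module.End.one_eq_id]
  rw [hmap, LinearMap.ker_neg, h24] at hD
  omega

end JacobianSide

/-! ### §4 Assembly: the named fact from `H¹(J) ≅ H¹(C)`, the `F₂₁`-curve and Weil type `(6,6)` -/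

section Assembly

/-- **`exists_heckePrymDatum_F21` from `isIso_bettiCohomology_map_abelJacobi`, an étale `F₂₁`-curve
with a Jacobian of dimension `43`, and Weil TYPE `(6, 6)` of its Hecke–Prym.** Granted the named
fact `Motives.isIso_bettiCohomology_map_abelJacobi` (`H¹(J(C)) ≅ H¹(C)`): if there is a smooth
projective complex curve `C` with a Jacobian `𝒥` of dimension `43` and fixed-point-free
automorphisms `σ⁷ = 𝟙`, `τ³ = 𝟙`, `σ ≫ τ = τ ≫ σ ≫ σ` (Riemann's existence theorem for the
generating vector `(σ, τ, 1; 1, 1, 1)` of `F₂₁` of type `(3; —)`, [LangeRodriguez2022, Thm. 3.1.1];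
Jacobians exist, [Milne1986JacobianVarieties]) such that, for `s = σ_*`, `t = τ_*`,
`e_N = Σ_{i<7} sⁱ`, any restrictions `s_B`, `t_B` to `B = (ker e_N)⁰` and any `φ'` on
`P' = (ker(𝟙_B - t_B))⁰` over the Hecke element `η_B`, the pair `(P', φ')` is of Weil TYPE
`(6, 6)` — `dim (ker(φ'^* - i√7) ∩ H^{1,0}(P')) = 6`, the HOLOMORPHIC Chevalley–Weil count
`H^{1,0}(C) = 1 ⊕ 2·Reg` ([ChevalleyWeil1934Integrale]) — THEN the named fact holds:
`dim P' = 12` is `dim_kerComponent_id_sub_eq_twelve_of_isIso` (this file), and the rest is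
`exists_heckePrymDatum_F21_of_weilType`. This isolates the residue of the fact in the tree:
Riemann's existence theorem for `F₂₁`, the Jacobian, `H¹(J) ≅ H¹(C)`, and the holomorphic
multiplicity `(6, 6)`.
[cite: LangeRodriguez2022, Thm. 3.1.1 (PDF p. 52), §3.2 (3.5)–(3.6) (PDF p. 56) and §3.5 Cor. 3.5.9–3.5.10 (PDF pp. 70–71)]
[cite: vanGeemen1994HodgeAV, 4.9–4.10 (PDF p. 218) and Lemma 5.2 (6) (PDF p. 220)] -/
theorem exists_heckePrymDatum_F21_of_isIso_of_weilType
    (hI : Motives.isIso_bettiCohomology_map_abelJacobi)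
    (h : ∃ (C : SchemeOver ℂ) (𝒥 : Jacobian C) (σ τ : C ⟶ C),
      IsSmoothProjective 1 C ∧ 𝒥.J.dim = 43 ∧
      σ ≫ σ ≫ σ ≫ σ ≫ σ ≫ σ ≫ σ = 𝟙 C ∧ τ ≫ τ ≫ τ = 𝟙 C ∧ σ ≫ τ = τ ≫ σ ≫ σ ∧
      (∀ P : ComplexPoints C, P ≫ σ ≠ P ∧ P ≫ τ ≠ P) ∧
      ∀ (s t eN : 𝒥.J ⟶ 𝒥.J), s = 𝒥.pushforward 𝒥 σ → t = 𝒥.pushforward 𝒥 τ →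
        eN = 𝟙 𝒥.J + s + s ≫ s + s ≫ s ≫ s + s ≫ s ≫ s ≫ s + s ≫ s ≫ s ≫ s ≫ s +
          s ≫ s ≫ s ≫ s ≫ s ≫ s →
      ∀ (sB tB : AbelianVariety.kerComponent eN ⟶ AbelianVariety.kerComponent eN),
        sB ≫ AbelianVariety.kerComponentι eN = AbelianVariety.kerComponentι eN ≫ s →
        tB ≫ AbelianVariety.kerComponentι eN = AbelianVariety.kerComponentι eN ≫ t →
      ∀ φ' : AbelianVariety.kerComponent (𝟙 (AbelianVariety.kerComponent eN) - tB) ⟶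
          AbelianVariety.kerComponent (𝟙 (AbelianVariety.kerComponent eN) - tB),
        φ' ≫ AbelianVariety.kerComponentι (𝟙 (AbelianVariety.kerComponent eN) - tB) =
          AbelianVariety.kerComponentι (𝟙 (AbelianVariety.kerComponent eN) - tB) ≫
            (sB + sB ≫ sB + sB ≫ sB ≫ sB ≫ sB - sB ≫ sB ≫ sB - sB ≫ sB ≫ sB ≫ sB ≫ sB -
              sB ≫ sB ≫ sB ≫ sB ≫ sB ≫ sB) →
      ∀ hP : IsSmoothProjective 12
          (AbelianVariety.kerComponent (𝟙 (AbelianVariety.kerComponent eN) - tB)).X,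
        Module.finrank ℂ ↥(Module.End.eigenspace (complexBetti.map φ'.hom.hom.hom 1).hom
              (Complex.I * (Real.sqrt (7 : ℝ) : ℂ)) ⊓ hodgeOneZero hP) = 6) :
    exists_heckePrymDatum_F21 := by
  obtain ⟨C, 𝒥, σ, τ, hC, hdim, hσ, hτ, hστ, hfree, hgeo⟩ := h
  refine exists_heckePrymDatum_F21_of_weilType ⟨C, 𝒥, σ, τ, hC, hdim, hσ, hτ, hστ, hfree, ?_⟩
  intro s t eN hs ht heN sB tB hsB htB
  refine ⟨dim_kerComponent_id_sub_eq_twelve_of_isIso 𝒥 hI hC hdim hσ hτ hστ hfree hs ht heN htB, ?_⟩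
  intro φ' hφ'
  exact hgeo s t eN hs ht heN sB tB hsB htB φ' hφ' _

end Assembly

end Literature.AlgebraicGeometry.HodgeTheory

end
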